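import Literature.Analysis.Distribution.BracketGeneratingLift
import HarnessLib

/-!
# Bracket-generating families on a product space

Topic `Literature/Analysis/Distribution`; three small definitions and theorems, no named facts.
Given Hörmander families `X : Option ι → E → E` on `E` and `X' : Option ι' → F → F` on `F`
(`none ↦` the drift), the **product family** on `E × F`,

  `prodFamily X X' none = (X₀ x, X₀' y)`,  `prodFamily X X' (inl i) = (X_i x, 0)`,
  `prodFamily X X' (inr j) = (0, X'_j y)`,

is the family of the operator `L_x + L'_y` acting on functions of `(x, y)` (here: the sum of a
Hörmander operator in `x` and of another in `y`, sharing ONE drift word — as for the operator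
`L_x + L*_y - 2∂_t` solved by the transition densities `p_t(x, y)` of a diffusion jointly in
the backward variable `x` and the forward variable `y`). Brackets of fields depending on `x`
only with the product drift only see its `x`-component (`lieBracket_pairField_inlField`, …),
so every proper iterated bracket of `X` embeds as a proper iterated bracket of the product family
(`IsIteratedLieBracket.inl`), and:

* `bracketSpanModAt_prodFamily_eq_top` — **if `X` generates `E` at `x` and `X'` generates `F` at
  `y` WITHOUT their bare drift words, the product family generates `E × F` at `(x, y)` without
  its bare drift word** — the hypothesis shape of `isBracketGenerating_lift` (time lift), whence
  the bracket condition for `L_x + L'_y + a ∂_t` on `ℝ × E × F`.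

## References

* L. Hörmander, *Hypoelliptic second order differential equations*, Acta Math. 119 (1967),
  Thm 1.1 (the bracket condition). [folklore]
-/

noncomputable section

open Set Filter VectorField
open scoped ContDiff Topology

namespace Literature.Analysis.Distribution

variable {E F : Type*} [NormedAddCommGroup E] [NormedSpace ℝ E] [NormedAddCommGroup F]
  [NormedSpace ℝ F]

/-! ### Fields on the product acting on one factor -/

/-- The field `(x, y) ↦ (V x, 0)` on `E × F`. [folklore] -/
def inlField (V : E → E) : E × F → E × F := fun p => (V p.1, 0)

/-- The field `(x, y) ↦ (0, W y)` on `E × F`. [folklore] -/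
def inrField (W : F → F) : E × F → E × F := fun p => (0, W p.2)

/-- The field `(x, y) ↦ (V x, W y)` on `E × F` (the product drift). [folklore] -/
def pairField (V : E → E) (W : F → F) : E × F → E × F := fun p => (V p.1, W p.2)

omit [NormedAddCommGroup E] [NormedSpace ℝ E] [NormedSpace ℝ F] in
/-- Unfolding `inlField`. [folklore] -/
@[simp] theorem inlField_apply (V : E → E) (p : E × F) : inlField (F := F) V p = (V p.1, 0) := rfl

omit [NormedSpace ℝ E] [NormedAddCommGroup F] [NormedSpace ℝ F] in
/-- Unfolding `inrField`. [folklore] -/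
@[simp] theorem inrField_apply (W : F → F) (p : E × F) : inrField (E := E) W p = (0, W p.2) := rfl

omit [NormedAddCommGroup E] [NormedSpace ℝ E] [NormedAddCommGroup F] [NormedSpace ℝ F] in
/-- Unfolding `pairField`. [folklore] -/
@[simp] theorem pairField_apply (V : E → E) (W : F → F) (p : E × F) :
    pairField V W p = (V p.1, W p.2) := rfl

omit [NormedSpace ℝ E] [NormedSpace ℝ F] in
/-- `inlField 0 = 0`. [folklore] -/
@[simp] theorem inlField_zero : inlField (F := F) (0 : E → E) = 0 := by
  funext p; simp [inlField]

omit [NormedSpace ℝ E] [NormedSpace ℝ F] in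
/-- `inrField 0 = 0`. [folklore] -/
@[simp] theorem inrField_zero : inrField (E := E) (0 : F → F) = 0 := by
  funext p; simp [inrField]

/-- The derivative of `inlField V`. [folklore] -/
theorem hasFDerivAt_inlField {V : E → E} {p : E × F} (hV : DifferentiableAt ℝ V p.1) :
    HasFDerivAt (inlField (F := F) V)
      (((fderiv ℝ V p.1).comp (ContinuousLinearMap.fst ℝ E F)).prod (0 : E × F →L[ℝ] F)) p :=
  (hV.hasFDerivAt.comp p hasFDerivAt_fst).prodMk (hasFDerivAt_const 0 p)

/-- The derivative of `inrField W`. [folklore] -/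
theorem hasFDerivAt_inrField {W : F → F} {p : E × F} (hW : DifferentiableAt ℝ W p.2) :
    HasFDerivAt (inrField (E := E) W)
      ((0 : E × F →L[ℝ] E).prod ((fderiv ℝ W p.2).comp (ContinuousLinearMap.snd ℝ E F))) p :=
  (hasFDerivAt_const 0 p).prodMk (hW.hasFDerivAt.comp p hasFDerivAt_snd)

/-- The derivative of `pairField V W`. [folklore] -/
theorem hasFDerivAt_pairField {V : E → E} {W : F → F} {p : E × F} (hV : DifferentiableAt ℝ V p.1)
    (hW : DifferentiableAt ℝ W p.2) :
    HasFDerivAt (pairField V W)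
      (((fderiv ℝ V p.1).comp (ContinuousLinearMap.fst ℝ E F)).prod
        ((fderiv ℝ W p.2).comp (ContinuousLinearMap.snd ℝ E F))) p :=
  (hV.hasFDerivAt.comp p hasFDerivAt_fst).prodMk (hW.hasFDerivAt.comp p hasFDerivAt_snd)

/-- Smoothness of `inlField`. [folklore] -/
theorem contDiff_inlField {n : WithTop ℕ∞} {V : E → E} (hV : ContDiff ℝ n V) :
    ContDiff ℝ n (inlField (F := F) V) :=
  (hV.comp contDiff_fst).prodMk contDiff_const

/-- Smoothness of `inrField`. [folklore] -/
theorem contDiff_inrField {n : WithTop ℕ∞} {W : F → F} (hW : ContDiff ℝ n W) :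
    ContDiff ℝ n (inrField (E := E) W) :=
  contDiff_const.prodMk (hW.comp contDiff_snd)

/-- Smoothness of `pairField`. [folklore] -/
theorem contDiff_pairField {n : WithTop ℕ∞} {V : E → E} {W : F → F} (hV : ContDiff ℝ n V)
    (hW : ContDiff ℝ n W) : ContDiff ℝ n (pairField V W) :=
  (hV.comp contDiff_fst).prodMk (hW.comp contDiff_snd)

/-! ### Brackets -/

/-- `[inlField U, inlField V] = inlField [U, V]`. [folklore] -/
theorem lieBracket_inlField_inlField {U V : E → E} (hU : Differentiable ℝ U) (hV : Differentiable ℝ V) :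
    VectorField.lieBracket ℝ (inlField (F := F) U) (inlField V) = inlField (VectorField.lieBracket ℝ U V) := by
  funext p
  show fderiv ℝ (inlField V) p (inlField U p) - fderiv ℝ (inlField U) p (inlField V p) =
    (VectorField.lieBracket ℝ U V p.1, (0 : F))
  rw [(hasFDerivAt_inlField (hV p.1)).fderiv, (hasFDerivAt_inlField (hU p.1)).fderiv]
  simp [lieBracket]

/-- `[inrField U, inrField V] = inrField [U, V]`. [folklore] -/
theorem lieBracket_inrField_inrField {U V : F → F} (hU : Differentiable ℝ U) (hV : Differentiable ℝ V) :
    VectorField.lieBracket ℝ (inrField (E := E) U) (inrField V) = inrField (VectorField.lieBracket ℝ U V) := by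
  funext p
  show fderiv ℝ (inrField V) p (inrField U p) - fderiv ℝ (inrField U) p (inrField V p) =
    ((0 : E), VectorField.lieBracket ℝ U V p.2)
  rw [(hasFDerivAt_inrField (hV p.2)).fderiv, (hasFDerivAt_inrField (hU p.2)).fderiv]
  simp [lieBracket]

/-- **The product drift brackets with an `x`-field through its `x`-component**:
`[pairField U U', inlField V] = inlField [U, V]`. [folklore] -/
theorem lieBracket_pairField_inlField {U V : E → E} {U' : F → F} (hU : Differentiable ℝ U)
    (hU' : Differentiable ℝ U') (hV : Differentiable ℝ V) :
    VectorField.lieBracket ℝ (pairField U U') (inlField V) = inlField (VectorField.lieBracket ℝ U V) := by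
  funext p
  show fderiv ℝ (inlField V) p (pairField U U' p) - fderiv ℝ (pairField U U') p (inlField V p) =
    (VectorField.lieBracket ℝ U V p.1, (0 : F))
  rw [(hasFDerivAt_inlField (hV p.1)).fderiv, (hasFDerivAt_pairField (hU p.1) (hU' p.2)).fderiv]
  simp [lieBracket]

/-- `[inlField V, pairField U U'] = inlField [V, U]`. [folklore] -/
theorem lieBracket_inlField_pairField {U V : E → E} {U' : F → F} (hU : Differentiable ℝ U)
    (hU' : Differentiable ℝ U') (hV : Differentiable ℝ V) :
    VectorField.lieBracket ℝ (inlField V) (pairField U U') = inlField (VectorField.lieBracket ℝ V U) := by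
  funext p
  show fderiv ℝ (pairField U U') p (inlField V p) - fderiv ℝ (inlField V) p (pairField U U' p) =
    (VectorField.lieBracket ℝ V U p.1, (0 : F))
  rw [(hasFDerivAt_inlField (hV p.1)).fderiv, (hasFDerivAt_pairField (hU p.1) (hU' p.2)).fderiv]
  simp [lieBracket]

/-- `[pairField U U', inrField W] = inrField [U', W]`. [folklore] -/
theorem lieBracket_pairField_inrField {U : E → E} {U' W : F → F} (hU : Differentiable ℝ U)
    (hU' : Differentiable ℝ U') (hW : Differentiable ℝ W) :
    VectorField.lieBracket ℝ (pairField U U') (inrField W) = inrField (VectorField.lieBracket ℝ U' W) := by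
  funext p
  show fderiv ℝ (inrField W) p (pairField U U' p) - fderiv ℝ (pairField U U') p (inrField W p) =
    ((0 : E), VectorField.lieBracket ℝ U' W p.2)
  rw [(hasFDerivAt_inrField (hW p.2)).fderiv, (hasFDerivAt_pairField (hU p.1) (hU' p.2)).fderiv]
  simp [lieBracket]

/-- `[inrField W, pairField U U'] = inrField [W, U']`. [folklore] -/
theorem lieBracket_inrField_pairField {U : E → E} {U' W : F → F} (hU : Differentiable ℝ U)
    (hU' : Differentiable ℝ U') (hW : Differentiable ℝ W) :
    VectorField.lieBracket ℝ (inrField W) (pairField U U') = inrField (VectorField.lieBracket ℝ W U') := by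
  funext p
  show fderiv ℝ (pairField U U') p (inrField W p) - fderiv ℝ (inrField W) p (pairField U U' p) =
    ((0 : E), VectorField.lieBracket ℝ W U' p.2)
  rw [(hasFDerivAt_inrField (hW p.2)).fderiv, (hasFDerivAt_pairField (hU p.1) (hU' p.2)).fderiv]
  simp [lieBracket]

/-! ### The product family -/

section Prod

variable {ι ι' : Type*} (X : Option ι → E → E) (X' : Option ι' → F → F)

/-- The **product family** on `E × F`: the shared drift `(X₀, X₀')` and the other fields of each
family acting on its own factor. [folklore] -/
def prodFamily : Option (ι ⊕ ι') → E × F → E × F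
  | none => pairField (X none) (X' none)
  | some (Sum.inl i) => inlField (X (some i))
  | some (Sum.inr j) => inrField (X' (some j))

omit [NormedSpace ℝ E] [NormedSpace ℝ F] in
/-- The drift of the product family. [folklore] -/
@[simp] theorem prodFamily_none : prodFamily X X' none = pairField (X none) (X' none) := rfl

omit [NormedSpace ℝ E] [NormedSpace ℝ F] in
/-- The first-factor fields of the product family. [folklore] -/
@[simp] theorem prodFamily_inl (i : ι) : prodFamily X X' (some (Sum.inl i)) = inlField (X (some i)) := rfl

omit [NormedSpace ℝ E] [NormedSpace ℝ F] in
/-- The second-factor fields of the product family. [folklore] -/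
@[simp] theorem prodFamily_inr (j : ι') : prodFamily X X' (some (Sum.inr j)) = inrField (X' (some j)) := rfl

variable {X X'}

/-- The product family of smooth families is smooth. [folklore] -/
theorem contDiff_prodFamily (hX : ∀ i, ContDiff ℝ ∞ (X i)) (hX' : ∀ j, ContDiff ℝ ∞ (X' j))
    (k : Option (ι ⊕ ι')) : ContDiff ℝ ∞ (prodFamily X X' k) := by
  rcases k with _ | i | j
  · exact contDiff_pairField (hX none) (hX' none)
  · exact contDiff_inlField (hX _)
  · exact contDiff_inrField (hX' _)

/-- **Every iterated bracket of `X` other than the bare drift embeds**: for an iterated bracket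
`U` of `X`, either `U = X₀` or `inlField U` is an iterated bracket of the product family; and
brackets embed as PROPER brackets. [folklore] -/
theorem IsIteratedLieBracket.inl (hX : ∀ i, ContDiff ℝ ∞ (X i)) (hX' : ∀ j, ContDiff ℝ ∞ (X' j))
    {U : E → E} (hU : IsIteratedLieBracket X U) :
    (U = X none ∧ ∃ i, U = X i) ∨ IsProperIteratedLieBracket (prodFamily X X') (inlField U) ∨
      ∃ i, inlField (F := F) U = prodFamily X X' (some (Sum.inl i)) := by
  have hd : ∀ i, Differentiable ℝ (X i) := fun i => (hX i).differentiable (by simp)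
  have hd' : ∀ j, Differentiable ℝ (X' j) := fun j => (hX' j).differentiable (by simp)
  induction hU with
  | of i =>
    rcases i with _ | i
    · exact Or.inl ⟨rfl, none, rfl⟩
    · exact Or.inr (Or.inr ⟨i, rfl⟩)
  | lieBracket i hV ih =>
    rename_i V
    have hVd : Differentiable ℝ V := (hV.contDiff hX).differentiable (by simp)
    -- the lift of `V` as an iterated bracket of the product family (or `V = X₀`)
    refine Or.inr (Or.inl ?_)
    rcases ih with ⟨rfl, -⟩ | hlift | ⟨i', hi'⟩
    · -- `V = X₀`
      rcases i with _ | i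
      · -- `[X₀, X₀] = 0 = [Z₀, Z₀]`
        have h0 : inlField (F := F) (VectorField.lieBracket ℝ (X none) (X none)) =
            VectorField.lieBracket ℝ (prodFamily X X' none) (prodFamily X X' none) := by
          rw [lieBracket_self, lieBracket_self, inlField_zero]
        rw [h0]
        exact IsProperIteratedLieBracket.lieBracket none (IsIteratedLieBracket.of none)
      · have h1 : inlField (F := F) (VectorField.lieBracket ℝ (X (some i)) (X none)) =
            VectorField.lieBracket ℝ (prodFamily X X' (some (Sum.inl i))) (prodFamily X X' none) := by
          rw [prodFamily_inl, prodFamily_none, lieBracket_inlField_pairField (hd none) (hd' none) (hd _)]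
        rw [h1]
        exact IsProperIteratedLieBracket.lieBracket _ (IsIteratedLieBracket.of none)
    · -- `V` lifts to a proper iterated bracket
      have hVZ : IsIteratedLieBracket (prodFamily X X') (inlField (F := F) V) := hlift.isIteratedLieBracket
      rcases i with _ | i
      · have h1 : inlField (F := F) (VectorField.lieBracket ℝ (X none) V) =
            VectorField.lieBracket ℝ (prodFamily X X' none) (inlField V) := by
          rw [prodFamily_none, lieBracket_pairField_inlField (hd none) (hd' none) hVd]
        rw [h1]
        exact IsProperIteratedLieBracket.lieBracket none hVZ
      · have h1 : inlField (F := F) (VectorField.lieBracket ℝ (X (some i)) V) =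
            VectorField.lieBracket ℝ (prodFamily X X' (some (Sum.inl i))) (inlField V) := by
          rw [prodFamily_inl, lieBracket_inlField_inlField (hd _) hVd]
        rw [h1]
        exact IsProperIteratedLieBracket.lieBracket _ hVZ
    · -- `V = X_{i'}` a bare noise field, lifted to a bare field of the product family
      have hVZ : IsIteratedLieBracket (prodFamily X X') (inlField (F := F) V) := by
        rw [hi']; exact IsIteratedLieBracket.of _
      rcases i with _ | i
      · have h1 : inlField (F := F) (VectorField.lieBracket ℝ (X none) V) =
            VectorField.lieBracket ℝ (prodFamily X X' none) (inlField V) := by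
          rw [prodFamily_none, lieBracket_pairField_inlField (hd none) (hd' none) hVd]
        rw [h1]
        exact IsProperIteratedLieBracket.lieBracket none hVZ
      · have h1 : inlField (F := F) (VectorField.lieBracket ℝ (X (some i)) V) =
            VectorField.lieBracket ℝ (prodFamily X X' (some (Sum.inl i))) (inlField V) := by
          rw [prodFamily_inl, lieBracket_inlField_inlField (hd _) hVd]
        rw [h1]
        exact IsProperIteratedLieBracket.lieBracket _ hVZ

/-- Proper iterated brackets of `X` embed as proper iterated brackets of the product family.
[folklore] -/
theorem IsProperIteratedLieBracket.inl (hX : ∀ i, ContDiff ℝ ∞ (X i)) (hX' : ∀ j, ContDiff ℝ ∞ (X' j))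
    {U : E → E} (hU : IsProperIteratedLieBracket X U) :
    IsProperIteratedLieBracket (prodFamily X X') (inlField (F := F) U) := by
  have hd : ∀ i, Differentiable ℝ (X i) := fun i => (hX i).differentiable (by simp)
  have hd' : ∀ j, Differentiable ℝ (X' j) := fun j => (hX' j).differentiable (by simp)
  cases hU with
  | lieBracket i hV =>
    rename_i V
    have hVd : Differentiable ℝ V := (hV.contDiff hX).differentiable (by simp)
    -- the lift of `V`
    have hVZ : V = X none ∨ IsIteratedLieBracket (prodFamily X X') (inlField (F := F) V) := by
      rcases hV.inl (F := F) hX hX' with ⟨h, -⟩ | h | ⟨i', hi'⟩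
      · exact Or.inl h
      · exact Or.inr h.isIteratedLieBracket
      · exact Or.inr (by rw [hi']; exact IsIteratedLieBracket.of _)
    rcases hVZ with rfl | hVZ
    · rcases i with _ | i
      · have h0 : inlField (F := F) (VectorField.lieBracket ℝ (X none) (X none)) =
            VectorField.lieBracket ℝ (prodFamily X X' none) (prodFamily X X' none) := by
          rw [lieBracket_self, lieBracket_self, inlField_zero]
        rw [h0]
        exact IsProperIteratedLieBracket.lieBracket none (IsIteratedLieBracket.of none)
      · have h1 : inlField (F := F) (VectorField.lieBracket ℝ (X (some i)) (X none)) =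
            VectorField.lieBracket ℝ (prodFamily X X' (some (Sum.inl i))) (prodFamily X X' none) := by
          rw [prodFamily_inl, prodFamily_none, lieBracket_inlField_pairField (hd none) (hd' none) (hd _)]
        rw [h1]
        exact IsProperIteratedLieBracket.lieBracket _ (IsIteratedLieBracket.of none)
    · rcases i with _ | i
      · have h1 : inlField (F := F) (VectorField.lieBracket ℝ (X none) V) =
            VectorField.lieBracket ℝ (prodFamily X X' none) (inlField V) := by
          rw [prodFamily_none, lieBracket_pairField_inlField (hd none) (hd' none) hVd]
        rw [h1]
        exact IsProperIteratedLieBracket.lieBracket none hVZ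
      · have h1 : inlField (F := F) (VectorField.lieBracket ℝ (X (some i)) V) =
            VectorField.lieBracket ℝ (prodFamily X X' (some (Sum.inl i))) (inlField V) := by
          rw [prodFamily_inl, lieBracket_inlField_inlField (hd _) hVd]
        rw [h1]
        exact IsProperIteratedLieBracket.lieBracket _ hVZ

/-- Every iterated bracket of `X'` other than the bare drift embeds (second factor). [folklore] -/
theorem IsIteratedLieBracket.inr (hX : ∀ i, ContDiff ℝ ∞ (X i)) (hX' : ∀ j, ContDiff ℝ ∞ (X' j))
    {W : F → F} (hW : IsIteratedLieBracket X' W) :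
    W = X' none ∨ IsIteratedLieBracket (prodFamily X X') (inrField (E := E) W) := by
  have hd : ∀ i, Differentiable ℝ (X i) := fun i => (hX i).differentiable (by simp)
  have hd' : ∀ j, Differentiable ℝ (X' j) := fun j => (hX' j).differentiable (by simp)
  induction hW with
  | of j =>
    rcases j with _ | j
    · exact Or.inl rfl
    · exact Or.inr (by rw [← prodFamily_inr (X := X)]; exact IsIteratedLieBracket.of _)
  | lieBracket j hV ih =>
    rename_i V
    have hVd : Differentiable ℝ V := (hV.contDiff hX').differentiable (by simp)
    refine Or.inr ?_
    rcases ih with rfl | hVZ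
    · rcases j with _ | j
      · have h0 : inrField (E := E) (VectorField.lieBracket ℝ (X' none) (X' none)) =
            VectorField.lieBracket ℝ (prodFamily X X' none) (prodFamily X X' none) := by
          rw [lieBracket_self, lieBracket_self, inrField_zero]
        rw [h0]
        exact IsIteratedLieBracket.lieBracket none (IsIteratedLieBracket.of none)
      · have h1 : inrField (E := E) (VectorField.lieBracket ℝ (X' (some j)) (X' none)) =
            VectorField.lieBracket ℝ (prodFamily X X' (some (Sum.inr j))) (prodFamily X X' none) := by
          rw [prodFamily_inr, prodFamily_none, lieBracket_inrField_pairField (hd none) (hd' none) (hd' _)]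
        rw [h1]
        exact IsIteratedLieBracket.lieBracket _ (IsIteratedLieBracket.of none)
    · rcases j with _ | j
      · have h1 : inrField (E := E) (VectorField.lieBracket ℝ (X' none) V) =
            VectorField.lieBracket ℝ (prodFamily X X' none) (inrField V) := by
          rw [prodFamily_none, lieBracket_pairField_inrField (hd none) (hd' none) hVd]
        rw [h1]
        exact IsIteratedLieBracket.lieBracket none hVZ
      · have h1 : inrField (E := E) (VectorField.lieBracket ℝ (X' (some j)) V) =
            VectorField.lieBracket ℝ (prodFamily X X' (some (Sum.inr j))) (inrField V) := by
          rw [prodFamily_inr, lieBracket_inrField_inrField (hd' _) hVd]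
        rw [h1]
        exact IsIteratedLieBracket.lieBracket _ hVZ

/-- Proper iterated brackets of `X'` embed as proper iterated brackets of the product family.
[folklore] -/
theorem IsProperIteratedLieBracket.inr (hX : ∀ i, ContDiff ℝ ∞ (X i)) (hX' : ∀ j, ContDiff ℝ ∞ (X' j))
    {W : F → F} (hW : IsProperIteratedLieBracket X' W) :
    IsProperIteratedLieBracket (prodFamily X X') (inrField (E := E) W) := by
  have hd : ∀ i, Differentiable ℝ (X i) := fun i => (hX i).differentiable (by simp)
  have hd' : ∀ j, Differentiable ℝ (X' j) := fun j => (hX' j).differentiable (by simp)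
  cases hW with
  | lieBracket j hV =>
    rename_i V
    have hVd : Differentiable ℝ V := (hV.contDiff hX').differentiable (by simp)
    rcases hV.inr (E := E) hX hX' with rfl | hVZ
    · rcases j with _ | j
      · have h0 : inrField (E := E) (VectorField.lieBracket ℝ (X' none) (X' none)) =
            VectorField.lieBracket ℝ (prodFamily X X' none) (prodFamily X X' none) := by
          rw [lieBracket_self, lieBracket_self, inrField_zero]
        rw [h0]
        exact IsProperIteratedLieBracket.lieBracket none (IsIteratedLieBracket.of none)
      · have h1 : inrField (E := E) (VectorField.lieBracket ℝ (X' (some j)) (X' none)) =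
            VectorField.lieBracket ℝ (prodFamily X X' (some (Sum.inr j))) (prodFamily X X' none) := by
          rw [prodFamily_inr, prodFamily_none, lieBracket_inrField_pairField (hd none) (hd' none) (hd' _)]
        rw [h1]
        exact IsProperIteratedLieBracket.lieBracket _ (IsIteratedLieBracket.of none)
    · rcases j with _ | j
      · have h1 : inrField (E := E) (VectorField.lieBracket ℝ (X' none) V) =
            VectorField.lieBracket ℝ (prodFamily X X' none) (inrField V) := by
          rw [prodFamily_none, lieBracket_pairField_inrField (hd none) (hd' none) hVd]
        rw [h1]
        exact IsProperIteratedLieBracket.lieBracket none hVZ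
      · have h1 : inrField (E := E) (VectorField.lieBracket ℝ (X' (some j)) V) =
            VectorField.lieBracket ℝ (prodFamily X X' (some (Sum.inr j))) (inrField V) := by
          rw [prodFamily_inr, lieBracket_inrField_inrField (hd' _) hVd]
        rw [h1]
        exact IsProperIteratedLieBracket.lieBracket _ hVZ

/-- The restricted span of `X` at `x`, embedded as `· × {0}`, lies in the restricted span of the
product family at `(x, y)` (allowed sets: no bare drift on `E`; all bare noise fields of the
product). [folklore] -/
theorem inl_bracketSpanModAt_prodFamily_le (hX : ∀ i, ContDiff ℝ ∞ (X i)) (hX' : ∀ j, ContDiff ℝ ∞ (X' j))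
    {A : Set (Option ι)} (hA : none ∉ A) {B : Set (Option (ι ⊕ ι'))}
    (hB : ∀ i : ι, some (Sum.inl i) ∈ B) (x : E) (y : F) :
    (bracketSpanModAt X A x).map (LinearMap.inl ℝ E F) ≤ bracketSpanModAt (prodFamily X X') B (x, y) := by
  rw [Submodule.map_le_iff_le_comap, bracketSpanModAt, Submodule.span_le]
  rintro v ⟨V, hV, rfl⟩
  show ((V x, (0 : F)) : E × F) ∈ bracketSpanModAt (prodFamily X X') B (x, y)
  have hval : (V x, (0 : F)) = inlField (F := F) V (x, y) := rfl
  rw [hval]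
  rcases hV with ⟨i, hi, rfl⟩ | hV
  · rcases i with _ | i
    · exact absurd hi hA
    · refine Submodule.subset_span ⟨prodFamily X X' (some (Sum.inl i)), Or.inl ⟨_, hB i, rfl⟩, rfl⟩
  · exact Submodule.subset_span ⟨inlField V, Or.inr (hV.inl hX hX'), rfl⟩

/-- The restricted span of `X'` at `y`, embedded as `{0} × ·`, lies in the restricted span of the
product family at `(x, y)`. [folklore] -/
theorem inr_bracketSpanModAt_prodFamily_le (hX : ∀ i, ContDiff ℝ ∞ (X i)) (hX' : ∀ j, ContDiff ℝ ∞ (X' j))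
    {A' : Set (Option ι')} (hA' : none ∉ A') {B : Set (Option (ι ⊕ ι'))}
    (hB : ∀ j : ι', some (Sum.inr j) ∈ B) (x : E) (y : F) :
    (bracketSpanModAt X' A' y).map (LinearMap.inr ℝ E F) ≤ bracketSpanModAt (prodFamily X X') B (x, y) := by
  rw [Submodule.map_le_iff_le_comap, bracketSpanModAt, Submodule.span_le]
  rintro v ⟨W, hW, rfl⟩
  show (((0 : E), W y) : E × F) ∈ bracketSpanModAt (prodFamily X X') B (x, y)
  have hval : ((0 : E), W y) = inrField (E := E) W (x, y) := rfl
  rw [hval]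
  rcases hW with ⟨j, hj, rfl⟩ | hW
  · rcases j with _ | j
    · exact absurd hj hA'
    · refine Submodule.subset_span ⟨prodFamily X X' (some (Sum.inr j)), Or.inl ⟨_, hB j, rfl⟩, rfl⟩
  · exact Submodule.subset_span ⟨inrField W, Or.inr (hW.inr hX hX'), rfl⟩

/-- **The product family generates `E × F` without its bare drift word** as soon as each factor
family generates its factor without its bare drift word. [folklore] -/
theorem bracketSpanModAt_prodFamily_eq_top (hX : ∀ i, ContDiff ℝ ∞ (X i))
    (hX' : ∀ j, ContDiff ℝ ∞ (X' j)) {A : Set (Option ι)} (hA : none ∉ A) {A' : Set (Option ι')}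
    (hA' : none ∉ A') {B : Set (Option (ι ⊕ ι'))} (hB : ∀ i : ι, some (Sum.inl i) ∈ B)
    (hB' : ∀ j : ι', some (Sum.inr j) ∈ B) {x : E} {y : F} (hx : bracketSpanModAt X A x = ⊤)
    (hy : bracketSpanModAt X' A' y = ⊤) : bracketSpanModAt (prodFamily X X') B (x, y) = ⊤ := by
  set S := bracketSpanModAt (prodFamily X X') B (x, y) with hS
  have h1 : ∀ v : E, ((v, 0) : E × F) ∈ S := fun v => by
    have h := inl_bracketSpanModAt_prodFamily_le (X := X) (X' := X') hX hX' hA hB x y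
    rw [hx, Submodule.map_top] at h
    exact h (LinearMap.mem_range_self _ v)
  have h2 : ∀ w : F, ((0, w) : E × F) ∈ S := fun w => by
    have h := inr_bracketSpanModAt_prodFamily_le (X := X) (X' := X') hX hX' hA' hB' x y
    rw [hy, Submodule.map_top] at h
    exact h (LinearMap.mem_range_self _ w)
  rw [eq_top_iff]
  rintro ⟨v, w⟩ -
  have h := Submodule.add_mem _ (h1 v) (h2 w)
  simpa using h

end Prod

end Literature.Analysis.Distribution
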